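import Literature.NumberTheory.GaloisRepresentations.AdequacyDegreeP
import HarnessLib

/-!
# Adequacy ascends from a subgroup of index prime to `p` (GHT 2017, Remark 6.1)

Topic `NumberTheory/GaloisRepresentations`; a sibling of `ExtendedAdequateSubgroup.lean` (the notion
`Subgroup.IsExtendedAdequate`, GHT 2017 §1 = Thorne, Math. Z. 285 (2017) Def. 2.20),
`AdequacyDegreeP.lean` (GHT Thm 1.7) and `AdequateOfCoprimeOrder.lean` (`p ∤ |H|` ⇒ adequate).
Guralnick–Herzig–Tiep open §6 with the reduction used throughout the proof of their Theorem 6.15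
(e.g. in Prop. 6.8: "By Remark 6.1, without loss we may assume `G = H`"):

> Remark 6.1. Suppose that `G ≤ GL(V)` is a finite irreducible subgroup. Note that, to show
> `(G, V)` is adequate it suffices to show that `G⁺` is adequate on `V`. Indeed, any subgroup being
> weakly adequate implies that the spanning condition holds for `G`. Next, adequacy for any
> subgroup containing a Sylow `p`-subgroup of `G` implies that necessary vanishing of `H¹` for `G`.

(`G⁺ = O^{p'}(G)`, the subgroup generated by the `p`-elements, contains every Sylow `p`-subgroup.)
PROVED here for the tree's extended notion, in the form: if `H' ≤ H ≤ GL_n(k)` with `[H : H']`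
non-zero in `k` — for `char k = p` and `H` finite: `p ∤ [H : H']`, i.e. `H'` contains a Sylow
`p`-subgroup of `H` — and `H'` is adequate, then `H` is adequate.  Clause (iii) is monotone in the
subgroup; clauses (i) (`Hom(H, k) = H¹(H, k) = 0`, trivial action) and (ii) (`H¹(H, ad/Z) = 0`)
follow from the degree-one `cor ∘ res = [H : H']` argument, the tree's coset averaging
`MonomialAdequacy.exists_eq_sub_of_subgroup` (restriction to a subgroup of `k`-invertible index
reflects coboundaries).

* `Subgroup.IsExtendedAdequate.of_le_of_cast_relIndex_ne_zero` — any field `k`;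
* `Subgroup.IsExtendedAdequate.of_le_of_not_dvd_relIndex` — `char k = p`, `p ∤ [H : H']`.

## References

* [GuralnickHerzigTiep2017] R. M. Guralnick, F. Herzig, P. H. Tiep, *Adequate subgroups and
  indecomposable modules*, JEMS 19 (2017) = arXiv:1405.0043, Remark 6.1 (arXiv p. 19); used in
  the proof of Prop. 6.8 (p. 20).
* [Thorne2017TwoAdic] J. Thorne, Math. Z. 285 (2017), Def. 2.20.
-/

open scoped MatrixGroups Matrix

namespace Literature.NumberTheory.GaloisRepresentations

universe u

variable {k : Type u} [Field k] {n : ℕ}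

/-- **GHT 2017, Remark 6.1 (adequacy ascends from a subgroup of `k`-invertible index).**  If
`H' ≤ H ≤ GL_n(k)`, the index `[H : H']` is non-zero in `k`, and `H'` is adequate in the extended
sense, then so is `H`: (iii) the semisimple elements of `H'` already span `M_n(k)`; (i) and (ii)
by restriction–corestriction in degree one (`MonomialAdequacy.exists_eq_sub_of_subgroup`).
[cite: GuralnickHerzigTiep2017, Remark 6.1] -/
theorem Subgroup.IsExtendedAdequate.of_le_of_cast_relIndex_ne_zero {H H' : Subgroup (GL (Fin n) k)}
    (hle : H' ≤ H) (hidx : ((H'.relIndex H : ℕ) : k) ≠ 0) (hH' : Subgroup.IsExtendedAdequate H') :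
    Subgroup.IsExtendedAdequate H := by
  classical
  -- `K = H ∩ H'` as a subgroup of `H`, of index `[H : H']`
  let K : Subgroup H := H'.subgroupOf H
  have hKidx : ((K.index : ℕ) : k) ≠ 0 := hidx
  haveI : K.FiniteIndex := ⟨fun h0 => hKidx (by rw [h0, Nat.cast_zero])⟩
  -- an element of `K` as an element of `H'`
  have hmemK : ∀ x : H, x ∈ K ↔ (x : GL (Fin n) k) ∈ H' := fun x => Subgroup.mem_subgroupOf
  refine ⟨fun f => ?_, ?_, ?_⟩
  · -- (i) `Hom(H, k) = 0`: a homomorphism vanishing on `K` vanishes (trivial coefficients)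
    let φ : H → k := fun h => f (Additive.ofMul h)
    have hφ : ∀ g h : H, φ (g * h) = (1 : Representation k H k) g (φ h) + φ g := by
      intro g h
      simp only [φ, ofMul_mul, map_add, MonoidHom.one_apply, Module.End.one_apply]
      rw [add_comm]
    -- the restriction of `f` to `H'`
    let f' : Additive H' →+ k :=
      { toFun := fun a => f (Additive.ofMul ⟨((Additive.toMul a : H') : GL (Fin n) k),
          hle (Additive.toMul a).2⟩)
        map_zero' := by
          simp only [toMul_zero, Subgroup.coe_one]
          exact f.map_zero
        map_add' := fun a b => by
          rw [← f.map_add]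
          rfl }
    have hf' : f' = 0 := hH'.addMonoidHom_eq_zero f'
    have hφK : ∃ m : k, ∀ x ∈ K, φ x = (1 : Representation k H k) x m - m := by
      refine ⟨0, fun x hx => ?_⟩
      rw [MonoidHom.one_apply, Module.End.one_apply, sub_self]
      have hx' : (x : GL (Fin n) k) ∈ H' := (hmemK x).1 hx
      have e : φ x = f' (Additive.ofMul ⟨(x : GL (Fin n) k), hx'⟩) := by
        simp only [φ, f', AddMonoidHom.coe_mk, ZeroHom.coe_mk, toMul_ofMul]
      rw [e, hf', AddMonoidHom.zero_apply]
    obtain ⟨m, hm⟩ := MonomialAdequacy.exists_eq_sub_of_subgroup (1 : Representation k H k) K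
      hKidx φ hφ hφK
    ext x
    have := hm x
    rw [MonoidHom.one_apply, Module.End.one_apply, sub_self] at this
    exact this
  · -- (ii) `H¹(H, ad/Z) = 0`: coboundary on `K` (from `H'`), hence on `H`
    rw [cocycles₁_le_coboundaries₁_iff_forall]
    intro f hf
    change ∀ g h : H, f (g * h) = Subgroup.adModScalarRep H g (f h) + f g at hf
    change ∃ m, ∀ g : H, f g = Subgroup.adModScalarRep H g m - m
    refine MonomialAdequacy.exists_eq_sub_of_subgroup _ K hKidx f hf ?_
    -- restrict the cocycle to `H'`
    let f' : H' → Matrix (Fin n) (Fin n) k ⧸ scalarMatrices (Fin n) k :=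
      fun y => f ⟨(y : GL (Fin n) k), hle y.2⟩
    have hf' : ∀ g h : H', f' (g * h) = Subgroup.adModScalarRep H' g (f' h) + f' g :=
      fun g h => hf ⟨(g : GL (Fin n) k), hle g.2⟩ ⟨(h : GL (Fin n) k), hle h.2⟩
    have h2 := hH'.cocycles₁_le_coboundaries₁
    rw [cocycles₁_le_coboundaries₁_iff_forall] at h2
    obtain ⟨m, hm⟩ := h2 f' hf'
    refine ⟨m, fun x hx => ?_⟩
    have hx' : (x : GL (Fin n) k) ∈ H' := (hmemK x).1 hx
    have e : x = ⟨((⟨(x : GL (Fin n) k), hx'⟩ : H') : GL (Fin n) k), hle hx'⟩ := Subtype.ext rfl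
    have := hm ⟨(x : GL (Fin n) k), hx'⟩
    simp only [f'] at this
    rw [e]
    exact this
  · -- (iii) the semisimple elements of `H'` already span
    rw [eq_top_iff, ← hH'.semisimpleSpan_eq_top, Subgroup.semisimpleSpan_def,
      Subgroup.semisimpleSpan_def]
    refine Submodule.span_mono ?_
    rintro M ⟨h', hh', rfl⟩
    exact ⟨⟨(h' : GL (Fin n) k), hle h'.2⟩, hh', rfl⟩

/-- **GHT 2017, Remark 6.1, for `char k = p`: adequacy for a subgroup containing a Sylow
`p`-subgroup implies adequacy** — if `H' ≤ H ≤ GL_n(k)`, `p ∤ [H : H']` and `H'` is adequate in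
the extended sense, then so is `H`. [cite: GuralnickHerzigTiep2017, Remark 6.1] -/
theorem Subgroup.IsExtendedAdequate.of_le_of_not_dvd_relIndex {p : ℕ} [Fact p.Prime] [CharP k p]
    {H H' : Subgroup (GL (Fin n) k)} (hle : H' ≤ H) (hidx : ¬ p ∣ H'.relIndex H)
    (hH' : Subgroup.IsExtendedAdequate H') : Subgroup.IsExtendedAdequate H :=
  hH'.of_le_of_cast_relIndex_ne_zero hle fun h => hidx ((CharP.cast_eq_zero_iff k p _).1 h)

end Literature.NumberTheory.GaloisRepresentations
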